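import Literature.NumberTheory.LFunctions.XiHeatRayGaussian
import Mathlib.Analysis.SpecialFunctions.Gaussian.GaussianIntegral
import Mathlib.MeasureTheory.Integral.Gamma
import Mathlib.MeasureTheory.Measure.Lebesgue.Integral
import HarnessLib

/-!
# Laplace's method on a window with complex curvature: the core estimate

RH ladder column JENSEN, rung J-P(P3) «log band», BAND crux `XiDerivBandRealAllRates` of route
«JensenLogBand», line «band-one-window» (u-arc reshape), lead rh-jensen-prover g7 — infrastructure
lemma (S5, generic part) of HOME/rh-jensen-prover/g7-work/LINE-PLAN.md. RH-FREE real/complex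
analysis. WHAT THIS IS NOT: nothing here bears on zeros of `ζ` or the truth of RH.

After the phase of the arc integrand has been expanded at the saddle,
`Φ(φ₀ + ψ) − Φ(φ₀) = −w ψ² + E(ψ)` with `Re w > 0` (for the BAND line `w = (n+1)(α+iβ)/2`,
`α ≈ 1`, `|β| ≪ 1`) and a cubic remainder `‖E(ψ)‖ ≤ K|ψ|³` on the window `|ψ| ≤ ψ₁`
(`K ψ₁ ≤ Re w / 2`), and the amplitude written as `g(ψ)` with `‖g(ψ) − 1‖ ≤ η` (the `ζ`-ratio
across the window), the window integral is the complex Gaussian integral up to three explicit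
errors:

  `‖∫_{−ψ₁}^{ψ₁} e^{−wψ² + E(ψ)} g(ψ) dψ − (π/w)^{1/2}‖
      ≤ 4(1+η)K/(Re w)² + η √(π/Re w) + 2 e^{−Re w·ψ₁²}/(Re w·ψ₁)`

(`LogBandArc.laplace_window_core`): cubic perturbation (`∫|ψ|³e^{−(Re w/2)ψ²} = 4/(Re w)²`),
amplitude perturbation, and the two Gaussian tails (`∫_{ψ ≥ ψ₁} e^{−Re w ψ²} ≤ e^{−Re w ψ₁²}/(2 Re w ψ₁)`,
tree `integral_Iic_exp_neg_sq_div_le`); the main term is Mathlib's `integral_gaussian_complex`.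
Relative to the main term `|π/w|^{1/2} ≍ (Re w)^{−1/2}` the three errors are
`O(K (Re w)^{−3/2})`, `O(η)`, `O(e^{−Re w ψ₁²}(Re w)^{−1/2}/ψ₁)`.
-/

noncomputable section

-- single-problem summit: `Summit.RiemannHypothesis.RiemannHypothesis.…` is the tree convention
set_option linter.dupNamespace false

open Complex Real MeasureTheory intervalIntegral Set Filter

namespace Summit.RiemannHypothesis.RiemannHypothesis.Theorems.JensenPolynomials.LogBandArc

open Literature.NumberTheory.LFunctions

/-! ## Gaussian moments and tails (Mathlib's normal form `exp (-b * y ^ 2)`) -/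

/-- **`∫_ℝ |y|³ e^{-b y²} dy = 1/b²`** for `b > 0` (`= 2 ∫_0^∞ y³ e^{-b y²} dy = 2 · Γ(2)/(2b²)`).
[folklore] -/
theorem integral_abs_cube_mul_exp_neg_mul_sq {b : ℝ} (hb : 0 < b) :
    ∫ y : ℝ, |y| ^ 3 * Real.exp (-b * y ^ 2) = 1 / b ^ 2 := by
  have h1 : ∫ y : ℝ, |y| ^ 3 * Real.exp (-b * y ^ 2) =
      2 * ∫ y in Ioi (0:ℝ), y ^ 3 * Real.exp (-b * y ^ 2) := by
    have := integral_comp_abs (f := fun y : ℝ ↦ y ^ 3 * Real.exp (-b * y ^ 2))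
    have e : (fun x : ℝ => |x| ^ 3 * Real.exp (-b * |x| ^ 2)) =
        fun y : ℝ => |y| ^ 3 * Real.exp (-b * y ^ 2) := by
      funext y; rw [sq_abs]
    rw [e] at this
    exact this
  have h2 : ∫ y in Ioi (0:ℝ), y ^ 3 * Real.exp (-b * y ^ 2) = 1 / (2 * b ^ 2) := by
    have h := _root_.integral_rpow_mul_exp_neg_mul_rpow (p := 2) (q := 3) (b := b) (by norm_num)
      (by norm_num) hb
    have e : (fun x : ℝ ↦ x ^ (3:ℝ) * Real.exp (-b * x ^ (2:ℝ))) =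
        fun y : ℝ ↦ y ^ 3 * Real.exp (-b * y ^ 2) := by
      funext y
      rw [show (3:ℝ) = ((3:ℕ):ℝ) by norm_num, show (2:ℝ) = ((2:ℕ):ℝ) by norm_num,
        Real.rpow_natCast, Real.rpow_natCast]
    rw [e] at h
    rw [h]
    have e2 : (-((3:ℝ) + 1) / 2 : ℝ) = -2 := by norm_num
    have e3 : (((3:ℝ) + 1) / 2 : ℝ) = 2 := by norm_num
    have e4 : b ^ (-2 : ℝ) = 1 / b ^ 2 := by
      rw [Real.rpow_neg hb.le, show (2:ℝ) = ((2:ℕ):ℝ) by norm_num, Real.rpow_natCast, one_div]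
    have e5 : Real.Gamma 2 = 1 := by
      rw [show (2 : ℝ) = (1 : ℕ) + 1 by norm_num, Real.Gamma_nat_eq_factorial]
      simp
    rw [e2, e3, e4, e5]
    field_simp
  rw [h1, h2]
  field_simp

/-- `y ↦ |y|³ e^{-b y²}` is integrable for `b > 0`. [folklore] -/
theorem integrable_abs_cube_mul_exp_neg_mul_sq {b : ℝ} (hb : 0 < b) :
    Integrable fun y : ℝ ↦ |y| ^ 3 * Real.exp (-b * y ^ 2) := by
  have h := (integrable_rpow_mul_exp_neg_mul_sq hb (s := 3) (by norm_num)).norm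
  refine h.congr (Eventually.of_forall fun y ↦ ?_)
  simp only [norm_mul, Real.norm_eq_abs, abs_of_pos (Real.exp_pos _)]
  rw [show (3:ℝ) = ((3:ℕ):ℝ) by norm_num, Real.rpow_natCast, abs_pow]

/-- **Two-sided Gaussian tail**: for `b, R > 0`,
`∫_ℝ e^{-b y²} − ∫_{−R}^{R} e^{-b y²} ≤ (2/(bR)) e^{-b R²}` (tree `integral_Iic_exp_neg_sq_div_le`
with `t = 1/b`, twice). [folklore] -/
theorem integral_sub_intervalIntegral_exp_neg_mul_sq_le {b R : ℝ} (hb : 0 < b) (hR : 0 < R) :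
    (∫ y : ℝ, Real.exp (-b * y ^ 2)) - ∫ y in (-R)..R, Real.exp (-b * y ^ 2) ≤
      2 / (b * R) * Real.exp (-b * R ^ 2) := by
  have hi := integrable_exp_neg_mul_sq hb
  have h1 := intervalIntegral.integral_Iic_add_Ioi (f := fun y : ℝ ↦ Real.exp (-b * y ^ 2))
    (b := R) hi.integrableOn hi.integrableOn
  have h2 := intervalIntegral.integral_Iic_sub_Iic (f := fun y : ℝ ↦ Real.exp (-b * y ^ 2))
    (a := -R) (b := R) hi.integrableOn hi.integrableOn
  have hform : ∀ y : ℝ, Real.exp (-b * y ^ 2) = Real.exp (-(y ^ 2 / (1 / b))) := by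
    intro y; congr 1; field_simp
  have hleft : ∫ y in Iic (-R), Real.exp (-b * y ^ 2) ≤ 1 / (b * R) * Real.exp (-b * R ^ 2) := by
    have := integral_Iic_exp_neg_sq_div_le (t := 1 / b) (by positivity) hR
    simp only [← hform] at this
    calc ∫ y in Iic (-R), Real.exp (-b * y ^ 2) ≤ 1 / b / R * Real.exp (-b * R ^ 2) := this
      _ = 1 / (b * R) * Real.exp (-b * R ^ 2) := by rw [div_div]
  have hright : ∫ y in Ioi R, Real.exp (-b * y ^ 2) ≤ 1 / (b * R) * Real.exp (-b * R ^ 2) := by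
    have := integral_comp_neg_Ioi R (fun y : ℝ ↦ Real.exp (-b * y ^ 2))
    simp only [neg_sq] at this
    rw [this]
    exact hleft
  have : (∫ y : ℝ, Real.exp (-b * y ^ 2)) - ∫ y in (-R)..R, Real.exp (-b * y ^ 2) =
      (∫ y in Iic (-R), Real.exp (-b * y ^ 2)) + ∫ y in Ioi R, Real.exp (-b * y ^ 2) := by
    linarith
  rw [this]
  calc (∫ y in Iic (-R), Real.exp (-b * y ^ 2)) + ∫ y in Ioi R, Real.exp (-b * y ^ 2)
      ≤ 1 / (b * R) * Real.exp (-b * R ^ 2) + 1 / (b * R) * Real.exp (-b * R ^ 2) :=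
        add_le_add hleft hright
    _ = 2 / (b * R) * Real.exp (-b * R ^ 2) := by ring

/-- The complex Gaussian with the window removed: `‖∫_ℝ e^{−wψ²} − ∫_{−R}^{R} e^{−wψ²}‖ ≤
(2/(Re w · R)) e^{−Re w · R²}`. [folklore] -/
theorem norm_integral_sub_intervalIntegral_cexp_le {w : ℂ} {R : ℝ} (hw : 0 < w.re) (hR : 0 < R) :
    ‖(∫ y : ℝ, cexp (-w * (y : ℂ) ^ 2)) - ∫ y in (-R)..R, cexp (-w * (y : ℂ) ^ 2)‖ ≤
      2 / (w.re * R) * Real.exp (-w.re * R ^ 2) := by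
  have hi := integrable_cexp_neg_mul_sq hw
  have hir := integrable_exp_neg_mul_sq hw
  have h1 := intervalIntegral.integral_Iic_add_Ioi (f := fun y : ℝ ↦ cexp (-w * (y : ℂ) ^ 2))
    (b := R) hi.integrableOn hi.integrableOn
  have h2 := intervalIntegral.integral_Iic_sub_Iic (f := fun y : ℝ ↦ cexp (-w * (y : ℂ) ^ 2))
    (a := -R) (b := R) hi.integrableOn hi.integrableOn
  have hdec : (∫ y : ℝ, cexp (-w * (y : ℂ) ^ 2)) - ∫ y in (-R)..R, cexp (-w * (y : ℂ) ^ 2) =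
      (∫ y in Iic (-R), cexp (-w * (y : ℂ) ^ 2)) + ∫ y in Ioi R, cexp (-w * (y : ℂ) ^ 2) := by
    rw [← h1, ← h2]; ring
  rw [hdec]
  have hnorm : ∀ (S : Set ℝ), ‖∫ y in S, cexp (-w * (y : ℂ) ^ 2)‖ ≤
      ∫ y in S, Real.exp (-w.re * y ^ 2) := by
    intro S
    refine norm_integral_le_of_norm_le hir.integrableOn (Eventually.of_forall fun y ↦ ?_)
    rw [norm_cexp_neg_mul_sq]
  have hr1 := intervalIntegral.integral_Iic_add_Ioi (f := fun y : ℝ ↦ Real.exp (-w.re * y ^ 2))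
    (b := R) hir.integrableOn hir.integrableOn
  have hr2 := intervalIntegral.integral_Iic_sub_Iic (f := fun y : ℝ ↦ Real.exp (-w.re * y ^ 2))
    (a := -R) (b := R) hir.integrableOn hir.integrableOn
  have htail := integral_sub_intervalIntegral_exp_neg_mul_sq_le hw hR
  calc ‖(∫ y in Iic (-R), cexp (-w * (y : ℂ) ^ 2)) + ∫ y in Ioi R, cexp (-w * (y : ℂ) ^ 2)‖
      ≤ ‖∫ y in Iic (-R), cexp (-w * (y : ℂ) ^ 2)‖ + ‖∫ y in Ioi R, cexp (-w * (y : ℂ) ^ 2)‖ :=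
        norm_add_le _ _
    _ ≤ (∫ y in Iic (-R), Real.exp (-w.re * y ^ 2)) + ∫ y in Ioi R, Real.exp (-w.re * y ^ 2) :=
        add_le_add (hnorm _) (hnorm _)
    _ = (∫ y : ℝ, Real.exp (-w.re * y ^ 2)) - ∫ y in (-R)..R, Real.exp (-w.re * y ^ 2) := by
        linarith
    _ ≤ 2 / (w.re * R) * Real.exp (-w.re * R ^ 2) := htail

/-! ## The window estimate -/

/-- **Pointwise perturbation bound.** If `‖E‖ ≤ K|ψ|³ ≤ (Re w/2) ψ²` and `‖g − 1‖ ≤ η` then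
`‖e^{−wψ² + E} g − e^{−wψ²}‖ ≤ (1+η) K |ψ|³ e^{−(Re w/2)ψ²} + η e^{−Re w ψ²}`. [folklore] -/
theorem norm_window_integrand_sub_le {w E g : ℂ} {ψ K η : ℝ}
    (hE : ‖E‖ ≤ K * |ψ| ^ 3) (hEq : K * |ψ| ^ 3 ≤ w.re / 2 * ψ ^ 2) (hg : ‖g - 1‖ ≤ η) :
    ‖cexp (-w * (ψ : ℂ) ^ 2 + E) * g - cexp (-w * (ψ : ℂ) ^ 2)‖ ≤
      (1 + η) * (K * |ψ| ^ 3) * Real.exp (-(w.re / 2) * ψ ^ 2) + η * Real.exp (-w.re * ψ ^ 2) := by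
  have hgauss : ‖cexp (-w * (ψ : ℂ) ^ 2)‖ = Real.exp (-w.re * ψ ^ 2) := norm_cexp_neg_mul_sq w ψ
  have hsplit : cexp (-w * (ψ : ℂ) ^ 2 + E) * g - cexp (-w * (ψ : ℂ) ^ 2) =
      cexp (-w * (ψ : ℂ) ^ 2) * ((cexp E - 1) * g + (g - 1)) := by
    rw [Complex.exp_add]; ring
  rw [hsplit, norm_mul, hgauss]
  have hg1 : ‖g‖ ≤ 1 + η := by
    have h' : ‖g‖ ≤ ‖(1 : ℂ)‖ + ‖g - 1‖ := by
      calc ‖g‖ = ‖1 + (g - 1)‖ := by ring_nf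
        _ ≤ ‖(1 : ℂ)‖ + ‖g - 1‖ := norm_add_le _ _
    rw [norm_one] at h'
    linarith
  have hexpE : ‖cexp E - 1‖ ≤ ‖E‖ * Real.exp ‖E‖ := norm_cexp_sub_one_le_mul_exp E
  have hE' : ‖E‖ * Real.exp ‖E‖ ≤ K * |ψ| ^ 3 * Real.exp (w.re / 2 * ψ ^ 2) := by
    have hEn : 0 ≤ ‖E‖ := norm_nonneg _
    apply mul_le_mul hE (Real.exp_le_exp.2 (hE.trans hEq)) (Real.exp_pos _).le
    exact hEn.trans hE
  have hin : ‖(cexp E - 1) * g + (g - 1)‖ ≤ K * |ψ| ^ 3 * Real.exp (w.re / 2 * ψ ^ 2) * (1 + η) + η := by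
    calc ‖(cexp E - 1) * g + (g - 1)‖ ≤ ‖cexp E - 1‖ * ‖g‖ + ‖g - 1‖ := by
          refine (norm_add_le _ _).trans ?_
          rw [norm_mul]
      _ ≤ K * |ψ| ^ 3 * Real.exp (w.re / 2 * ψ ^ 2) * (1 + η) + η := by
          have hK3 : 0 ≤ K * |ψ| ^ 3 := (norm_nonneg E).trans hE
          have := mul_le_mul (hexpE.trans hE') hg1 (norm_nonneg g)
            (mul_nonneg hK3 (Real.exp_pos _).le)
          linarith
  have hpos : 0 ≤ Real.exp (-w.re * ψ ^ 2) := (Real.exp_pos _).le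
  calc Real.exp (-w.re * ψ ^ 2) * ‖(cexp E - 1) * g + (g - 1)‖
      ≤ Real.exp (-w.re * ψ ^ 2) * (K * |ψ| ^ 3 * Real.exp (w.re / 2 * ψ ^ 2) * (1 + η) + η) :=
        mul_le_mul_of_nonneg_left hin hpos
    _ = (1 + η) * (K * |ψ| ^ 3) * Real.exp (-(w.re / 2) * ψ ^ 2) + η * Real.exp (-w.re * ψ ^ 2) := by
        have : Real.exp (-w.re * ψ ^ 2) * Real.exp (w.re / 2 * ψ ^ 2) =
            Real.exp (-(w.re / 2) * ψ ^ 2) := by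
          rw [← Real.exp_add]; congr 1; ring
        calc Real.exp (-w.re * ψ ^ 2) * (K * |ψ| ^ 3 * Real.exp (w.re / 2 * ψ ^ 2) * (1 + η) + η)
            = (1 + η) * (K * |ψ| ^ 3) * (Real.exp (-w.re * ψ ^ 2) * Real.exp (w.re / 2 * ψ ^ 2)) +
              η * Real.exp (-w.re * ψ ^ 2) := by ring
          _ = _ := by rw [this]

/-- **Laplace's method on a window — the core estimate.** Let `Re w > 0`, `0 < ψ₁`, `0 ≤ K` with
`K ψ₁ ≤ Re w/2`, `0 ≤ η`; let `E, g` be continuous on `[−ψ₁, ψ₁]` with `‖E(ψ)‖ ≤ K|ψ|³` (cubic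
phase remainder) and `‖g(ψ) − 1‖ ≤ η` (amplitude variation). Then
`‖∫_{−ψ₁}^{ψ₁} e^{−wψ² + E(ψ)} g(ψ) dψ − (π/w)^{1/2}‖ ≤ 4(1+η)K/(Re w)² + η√(π/Re w) + (2/(Re w ψ₁)) e^{−Re w ψ₁²}`.
[folklore] -/
theorem laplace_window_core {w : ℂ} {ψ₁ K η : ℝ} (hw : 0 < w.re) (hψ₁ : 0 < ψ₁) (hK : 0 ≤ K)
    (hη : 0 ≤ η) (hKψ : K * ψ₁ ≤ w.re / 2) {E g : ℝ → ℂ}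
    (hEc : ContinuousOn E (Icc (-ψ₁) ψ₁)) (hgc : ContinuousOn g (Icc (-ψ₁) ψ₁))
    (hE : ∀ ψ ∈ Icc (-ψ₁) ψ₁, ‖E ψ‖ ≤ K * |ψ| ^ 3)
    (hg : ∀ ψ ∈ Icc (-ψ₁) ψ₁, ‖g ψ - 1‖ ≤ η) :
    ‖(∫ ψ in (-ψ₁)..ψ₁, cexp (-w * (ψ : ℂ) ^ 2 + E ψ) * g ψ) - ((π : ℂ) / w) ^ (1 / 2 : ℂ)‖ ≤
      4 * (1 + η) * K / w.re ^ 2 + η * Real.sqrt (π / w.re) +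
        2 / (w.re * ψ₁) * Real.exp (-w.re * ψ₁ ^ 2) := by
  have hle : -ψ₁ ≤ ψ₁ := by linarith
  set F : ℝ → ℂ := fun ψ => cexp (-w * (ψ : ℂ) ^ 2 + E ψ) * g ψ with hF
  set G : ℝ → ℂ := fun ψ => cexp (-w * (ψ : ℂ) ^ 2) with hG
  set bd : ℝ → ℝ := fun ψ => (1 + η) * (K * |ψ| ^ 3) * Real.exp (-(w.re / 2) * ψ ^ 2) +
    η * Real.exp (-w.re * ψ ^ 2) with hbd
  -- integrability
  have hGi : Integrable G := integrable_cexp_neg_mul_sq hw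
  have hGc : Continuous G := by simp only [hG]; fun_prop
  have hFc : ContinuousOn F (Icc (-ψ₁) ψ₁) := by
    simp only [hF]
    exact ((Continuous.continuousOn (by fun_prop)).add hEc).cexp.mul hgc
  have hFint : IntervalIntegrable F volume (-ψ₁) ψ₁ :=
    (hFc.mono (by rw [uIcc_of_le hle])).intervalIntegrable
  have hGint : IntervalIntegrable G volume (-ψ₁) ψ₁ := hGc.intervalIntegrable _ _
  have hbdi : Integrable bd := by
    simp only [hbd]
    refine Integrable.add ?_ ((integrable_exp_neg_mul_sq hw).const_mul η)
    have := (integrable_abs_cube_mul_exp_neg_mul_sq (b := w.re / 2) (by positivity)).const_mul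
      ((1 + η) * K)
    refine this.congr (Eventually.of_forall fun ψ => ?_)
    simp only; ring
  have hbd0 : ∀ ψ, 0 ≤ bd ψ := fun ψ => by simp only [hbd]; positivity
  -- the Gaussian
  have hgauss : (∫ ψ : ℝ, G ψ) = ((π : ℂ) / w) ^ (1 / 2 : ℂ) := integral_gaussian_complex hw
  -- decomposition
  have hsplit : (∫ ψ in (-ψ₁)..ψ₁, F ψ) - ((π : ℂ) / w) ^ (1 / 2 : ℂ) =
      (∫ ψ in (-ψ₁)..ψ₁, (F ψ - G ψ)) - ((∫ ψ : ℝ, G ψ) - ∫ ψ in (-ψ₁)..ψ₁, G ψ) := by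
    rw [intervalIntegral.integral_sub hFint hGint, hgauss]; ring
  -- the perturbation integral
  have hpert : ‖∫ ψ in (-ψ₁)..ψ₁, (F ψ - G ψ)‖ ≤ 4 * (1 + η) * K / w.re ^ 2 + η * Real.sqrt (π / w.re) := by
    have hpt : ∀ ψ ∈ Icc (-ψ₁) ψ₁, ‖F ψ - G ψ‖ ≤ bd ψ := by
      intro ψ hψ
      have habs : |ψ| ≤ ψ₁ := abs_le.2 ⟨hψ.1, hψ.2⟩
      have hEq : K * |ψ| ^ 3 ≤ w.re / 2 * ψ ^ 2 := by
        have h1 : K * |ψ| ≤ w.re / 2 := (mul_le_mul_of_nonneg_left habs hK).trans hKψ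
        have : K * |ψ| ^ 3 = K * |ψ| * ψ ^ 2 := by rw [← sq_abs]; ring
        rw [this]
        exact mul_le_mul_of_nonneg_right h1 (sq_nonneg ψ)
      exact norm_window_integrand_sub_le (hE ψ hψ) hEq (hg ψ hψ)
    calc ‖∫ ψ in (-ψ₁)..ψ₁, (F ψ - G ψ)‖ ≤ ∫ ψ in (-ψ₁)..ψ₁, bd ψ := by
          refine intervalIntegral.norm_integral_le_of_norm_le hle ?_
            (hbdi.intervalIntegrable)
          exact Eventually.of_forall fun ψ hψ => hpt ψ ⟨hψ.1.le, hψ.2⟩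
      _ ≤ ∫ ψ : ℝ, bd ψ := by
          rw [intervalIntegral.integral_of_le hle]
          exact setIntegral_le_integral hbdi (Eventually.of_forall hbd0)
      _ = 4 * (1 + η) * K / w.re ^ 2 + η * Real.sqrt (π / w.re) := by
          have hI1 : Integrable (fun ψ : ℝ =>
              (1 + η) * (K * |ψ| ^ 3) * Real.exp (-(w.re / 2) * ψ ^ 2)) := by
            have := (integrable_abs_cube_mul_exp_neg_mul_sq (b := w.re / 2) (by positivity)).const_mul
              ((1 + η) * K)
            refine this.congr (Eventually.of_forall fun ψ => ?_)
            simp only; ring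
          have hI2 : Integrable (fun ψ : ℝ => η * Real.exp (-w.re * ψ ^ 2)) :=
            (integrable_exp_neg_mul_sq hw).const_mul η
          have e1 : (∫ ψ : ℝ, (1 + η) * (K * |ψ| ^ 3) * Real.exp (-(w.re / 2) * ψ ^ 2)) =
              (1 + η) * K * (1 / (w.re / 2) ^ 2) := by
            have : (fun ψ : ℝ => (1 + η) * (K * |ψ| ^ 3) * Real.exp (-(w.re / 2) * ψ ^ 2)) =
                fun ψ : ℝ => ((1 + η) * K) * (|ψ| ^ 3 * Real.exp (-(w.re / 2) * ψ ^ 2)) := by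
              funext ψ; ring
            rw [this, MeasureTheory.integral_const_mul,
              integral_abs_cube_mul_exp_neg_mul_sq (by positivity)]
          have e2 : (∫ ψ : ℝ, η * Real.exp (-w.re * ψ ^ 2)) = η * Real.sqrt (π / w.re) := by
            rw [MeasureTheory.integral_const_mul, integral_gaussian]
          simp only [hbd]
          rw [MeasureTheory.integral_add hI1 hI2, e1, e2]
          field_simp
          ring
  have htail := norm_integral_sub_intervalIntegral_cexp_le hw hψ₁
  rw [hsplit]
  calc ‖(∫ ψ in (-ψ₁)..ψ₁, (F ψ - G ψ)) - ((∫ ψ : ℝ, G ψ) - ∫ ψ in (-ψ₁)..ψ₁, G ψ)‖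
      ≤ ‖∫ ψ in (-ψ₁)..ψ₁, (F ψ - G ψ)‖ + ‖(∫ ψ : ℝ, G ψ) - ∫ ψ in (-ψ₁)..ψ₁, G ψ‖ :=
        norm_sub_le _ _
    _ ≤ (4 * (1 + η) * K / w.re ^ 2 + η * Real.sqrt (π / w.re)) +
        2 / (w.re * ψ₁) * Real.exp (-w.re * ψ₁ ^ 2) := add_le_add hpert htail
    _ = _ := by ring


end Summit.RiemannHypothesis.RiemannHypothesis.Theorems.JensenPolynomials.LogBandArc

end
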